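/-
Copyright (c) 2026. All rights reserved.
Released under Apache 2.0 license as described in the file LICENSE.
Authors: abc-iut cell, wave-2 seat abc-iut-L3-t11 (proof-only; G10 rung 3b, the tree-SYSTEM half of
[SemiAnbd] Thm 3.7 (iii) second part, parallel to abc-iut-L3-t6's `TreeSystemFixedPoint` for rung 3a).
-/
import Literature.AnabelianGeometry.SemiGraphs.TreeFixedPairProofs
import Literature.AnabelianGeometry.SemiGraphs.SubdivisionLemmas
import HarnessLib

/-!
# Compatible systems of fixed vertices in an inverse system of trees: at most two, and the adjacent pair

Mochizuki, *Semi-graphs of anabelioids*, Publ. RIMS **42** (2006) [MochizukiSemiAnbd2006], proof of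
Theorem 3.7 (iii), p. 41 (PRIMS p. 266), last paragraph: once total estrangement has excluded "`H` fixes
`≥ 3` vertices of `G_{∞,j}`" at all large levels, "`H` fixes at least one, but no more than two vertices of
`G_{∞,j}` … Moreover, by Lemma 1.8, (ii), (b), it follows that if `H` fixes two vertices of `G_{∞,j}`, then
these two vertices are joined to one another by a single [closed] edge. … there exists a compatible system
of vertices of `G_{∞,j}` … each of which is fixed by `H`. On the other hand, we may also conclude that there
exist at most two such compatible systems."

This PROOF-ONLY file is the abstract tree-system form of that paragraph (the counterpart, for the SECOND
part of (iii), of abc-iut-L3-t6's `TreeSystemFixedPoint.exists_compatible_fixed_vertices[_eventually]` for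
the first part), over a directed inverse system of trees `T j` with actions `ρ j : C →* Aut (T j)` and
equivariant transition maps on vertices, under the hypothesis `AT MOST TWO fixed vertices at every level
≥ j₀` (the output of the estrangement step):

* `finite_fixed_of_atMostTwo` — the fixed-vertex sets are then finite (the `hfixfin` input of t6's theorem);
* `ne_of_compatible_ne` — two compatible systems that differ at one level differ at all higher levels;
* `atMostTwo_compatible_fixed_systems` — there are at most two compatible systems of fixed vertices;
* `adjacent_of_compatible_fixed_systems` — two distinct compatible systems of fixed vertices are, at every
  large level, joined by a single CLOSED edge fixed together with its branches (Lemma 1.8 (ii)(b) in the form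
  `fixed_pair_adjacent_of_no_third`).

No definitions; nothing specific to anabelioids; the transport to verticial / edge-like subgroups is rung 1.
-/

namespace Literature.AnabelianGeometry.SemiGraphs

namespace SemiGraph

open CategoryTheory

universe w v u

variable {J : Type v} [Preorder J] [IsDirectedOrder J] (T : J → SemiGraph.{u}) {C : Type w} [Group C]
  (ρ : ∀ j, C →* Aut (T j))

/-! ### At most two fixed vertices per level ⇒ finite fixed sets -/

omit [Preorder J] [IsDirectedOrder J] in
/-- If at level `j` any three fixed vertices have two equal, the set of fixed vertices is finite (it has at
most two elements) — the `hfixfin` hypothesis of `exists_compatible_fixed_vertices`.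
[cite: MochizukiSemiAnbd2006, Thm. 3.7(iii) p.41] -/
theorem finite_fixed_of_atMostTwo (j : J)
    (htwo : ∀ a b c : (T j).Vertex, (∀ γ, (ρ j γ).hom.vertexMap a = a) →
      (∀ γ, (ρ j γ).hom.vertexMap b = b) → (∀ γ, (ρ j γ).hom.vertexMap c = c) → a = b ∨ b = c ∨ a = c) :
    {x : (T j).Vertex | ∀ γ : C, (ρ j γ).hom.vertexMap x = x}.Finite := by
  classical
  by_cases h0 : ∃ a : (T j).Vertex, ∀ γ, (ρ j γ).hom.vertexMap a = a
  · obtain ⟨a, ha⟩ := h0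
    by_cases h1 : ∃ b : (T j).Vertex, b ≠ a ∧ ∀ γ, (ρ j γ).hom.vertexMap b = b
    · obtain ⟨b, hba, hb⟩ := h1
      refine ((Set.finite_singleton b).insert a).subset ?_
      intro c hc
      rcases htwo a b c ha hb hc with h | h | h
      · exact absurd h.symm hba
      · exact Set.mem_insert_of_mem a (Set.mem_singleton_iff.mpr h.symm)
      · exact Set.mem_insert_iff.mpr (Or.inl h.symm)
    · refine (Set.finite_singleton a).subset ?_
      intro c hc
      by_contra hca
      exact h1 ⟨c, fun h => hca (Set.mem_singleton_iff.mpr h), hc⟩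
  · convert Set.finite_empty
    ext x
    simp only [Set.mem_setOf_eq, Set.mem_empty_iff_false, iff_false]
    exact fun hx => h0 ⟨x, hx⟩

/-! ### Compatible systems -/

variable (π : ∀ ⦃i j : J⦄, i ≤ j → (T j).Vertex → (T i).Vertex)

omit [IsDirectedOrder J] in
/-- Two compatible systems of vertices that differ at level `i` differ at every level `j ≥ i`.
[cite: MochizukiSemiAnbd2006, Thm. 3.7(iii) p.41] -/
theorem ne_of_compatible_ne {x y : ∀ j, (T j).Vertex} (hx : ∀ ⦃i j : J⦄ (h : i ≤ j), π h (x j) = x i)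
    (hy : ∀ ⦃i j : J⦄ (h : i ≤ j), π h (y j) = y i) {i : J} (hne : x i ≠ y i) {j : J} (hij : i ≤ j) :
    x j ≠ y j := by
  intro h
  apply hne
  rw [← hx hij, ← hy hij, h]

/-- **At most two compatible systems of fixed vertices**: if at every level `≥ j₀` any three fixed vertices
have two equal, then among any three compatible systems of fixed vertices two agree at every level (there
are no three pairwise-distinct ones). [cite: MochizukiSemiAnbd2006, Thm. 3.7(iii) p.41] -/
theorem atMostTwo_compatible_fixed_systems (j₀ : J)
    (htwo : ∀ j, j₀ ≤ j → ∀ a b c : (T j).Vertex, (∀ γ, (ρ j γ).hom.vertexMap a = a) →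
      (∀ γ, (ρ j γ).hom.vertexMap b = b) → (∀ γ, (ρ j γ).hom.vertexMap c = c) → a = b ∨ b = c ∨ a = c)
    {x y z : ∀ j, (T j).Vertex}
    (hx : ∀ ⦃i j : J⦄ (h : i ≤ j), π h (x j) = x i) (hy : ∀ ⦃i j : J⦄ (h : i ≤ j), π h (y j) = y i)
    (hz : ∀ ⦃i j : J⦄ (h : i ≤ j), π h (z j) = z i)
    (hxf : ∀ j γ, (ρ j γ).hom.vertexMap (x j) = x j) (hyf : ∀ j γ, (ρ j γ).hom.vertexMap (y j) = y j)
    (hzf : ∀ j γ, (ρ j γ).hom.vertexMap (z j) = z j)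
    {i₁ i₂ i₃ : J} (h₁ : x i₁ ≠ y i₁) (h₂ : y i₂ ≠ z i₂) (h₃ : x i₃ ≠ z i₃) : False := by
  -- a common upper bound of `j₀, i₁, i₂, i₃`
  obtain ⟨k₁, hk₀, hk₁⟩ := exists_ge_ge j₀ i₁
  obtain ⟨k₂, hk₂, hk₃⟩ := exists_ge_ge i₂ i₃
  obtain ⟨j, hj₁, hj₂⟩ := exists_ge_ge k₁ k₂
  have hxy := ne_of_compatible_ne T π hx hy h₁ (hk₁.trans hj₁)
  have hyz := ne_of_compatible_ne T π hy hz h₂ (hk₂.trans hj₂)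
  have hxz := ne_of_compatible_ne T π hx hz h₃ (hk₃.trans hj₂)
  rcases htwo j (hk₀.trans hj₁) (x j) (y j) (z j) (hxf j) (hyf j) (hzf j) with h | h | h
  · exact hxy h
  · exact hyz h
  · exact hxz h

omit [IsDirectedOrder J] in
/-- **Two distinct compatible systems of fixed vertices are adjacent at every large level**: if at every
level `≥ j₀` any three fixed vertices have two equal, and `x`, `y` are compatible systems of fixed vertices
of the TREES `T j` with `x i ≠ y i`, then at every level `j ≥ j₀, i` the vertices `x j ≠ y j` are joined by
a single CLOSED edge, fixed by `C` together with all its branches (Lemma 1.8 (ii)(b); a third fixed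
vertex is excluded). [cite: MochizukiSemiAnbd2006, Thm. 3.7(iii) p.41] -/
theorem adjacent_of_compatible_fixed_systems (hT : ∀ j, (T j).IsTree) (j₀ : J)
    (htwo : ∀ j, j₀ ≤ j → ∀ a b c : (T j).Vertex, (∀ γ, (ρ j γ).hom.vertexMap a = a) →
      (∀ γ, (ρ j γ).hom.vertexMap b = b) → (∀ γ, (ρ j γ).hom.vertexMap c = c) → a = b ∨ b = c ∨ a = c)
    {x y : ∀ j, (T j).Vertex}
    (hx : ∀ ⦃i j : J⦄ (h : i ≤ j), π h (x j) = x i) (hy : ∀ ⦃i j : J⦄ (h : i ≤ j), π h (y j) = y i)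
    (hxf : ∀ j γ, (ρ j γ).hom.vertexMap (x j) = x j) (hyf : ∀ j γ, (ρ j γ).hom.vertexMap (y j) = y j)
    {i : J} (hne : x i ≠ y i) {j : J} (hj₀ : j₀ ≤ j) (hij : i ≤ j) :
    ∃ (e : (T j).Edge) (c c' : (T j).Branch), (T j).IsClosedEdge e ∧ c ≠ c' ∧ (T j).edgeOf c = e ∧
      (T j).edgeOf c' = e ∧ (T j).abuts c = some (x j) ∧ (T j).abuts c' = some (y j) ∧
      ∀ γ, (ρ j γ).hom.edgeMap e = e ∧ ∀ b : (T j).Branch, (T j).edgeOf b = e → (ρ j γ).hom.branchMap b = b := by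
  have hxy : x j ≠ y j := ne_of_compatible_ne T π hx hy hne hij
  -- act through the IMAGE of `C` in `Aut (T j)` (same universe as the tree)
  let R : Subgroup (Aut (T j)) := (ρ j).range
  have hxR : ∀ g : R, (R.subtype g).hom.vertexMap (x j) = x j := by
    rintro ⟨_, γ, rfl⟩; exact hxf j γ
  have hyR : ∀ g : R, (R.subtype g).hom.vertexMap (y j) = y j := by
    rintro ⟨_, γ, rfl⟩; exact hyf j γ
  have hno3 : ∀ v : (T j).Vertex, (∀ g : R, (R.subtype g).hom.vertexMap v = v) → v = x j ∨ v = y j := by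
    intro v hv
    have hv' : ∀ γ, (ρ j γ).hom.vertexMap v = v := fun γ => hv ⟨ρ j γ, γ, rfl⟩
    rcases htwo j hj₀ (x j) (y j) v (hxf j) (hyf j) hv' with h | h | h
    · exact absurd h hxy
    · exact Or.inr h.symm
    · exact Or.inl h.symm
  obtain ⟨e, c, c', he, hcc, hce, hc'e, hcx, hc'y, hfix⟩ :=
    fixed_pair_adjacent_of_no_third R.subtype (hT j) hxy hxR hyR hno3
  exact ⟨e, c, c', he, hcc, hce, hc'e, hcx, hc'y, fun γ => hfix ⟨ρ j γ, γ, rfl⟩⟩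

/-- **In a tree two distinct vertices are joined by at most one edge**: if `e` and `e'` both have a
branch at `a` and a branch at `b ≠ a`, then `e = e'` (else `a – e – b – e' – a` is a circuit of the
subdivision). Hence the edge of `adjacent_of_compatible_fixed_systems` is unique at each level, and the
edges form a compatible system whenever the transition maps come from morphisms of semi-graphs.
[cite: MochizukiSemiAnbd2006, Thm. 3.7(iii) p.41] -/
theorem edge_unique_of_abuts {G : SemiGraph.{u}} (hG : G.IsTree) {a b : G.Vertex} (hab : a ≠ b)
    {e e' : G.Edge} {c d c' d' : G.Branch} (hce : G.edgeOf c = e) (hde : G.edgeOf d = e)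
    (hc'e : G.edgeOf c' = e') (hd'e : G.edgeOf d' = e') (hca : G.abuts c = some a) (hdb : G.abuts d = some b)
    (hc'a : G.abuts c' = some a) (hd'b : G.abuts d' = some b) : e = e' := by
  have hA : G.subdivision.IsAcyclic := hG.isTree.isAcyclic
  -- the path `a – c – e – d – b` for any such data
  have mkPath : ∀ {e : G.Edge} {c d : G.Branch}, G.edgeOf c = e → G.edgeOf d = e →
      G.abuts c = some a → G.abuts d = some b →
      ∃ p : G.subdivision.Walk (Sum.inl a) (Sum.inl b), p.IsPath ∧ p.getVert 2 = Sum.inr (Sum.inl e) := by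
    intro e c d hce hde hca hdb
    have hcd : c ≠ d := by
      intro h; subst h; rw [hca] at hdb; exact hab (by simpa using hdb)
    have a₁ : G.subdivision.Adj (Sum.inl a) (Sum.inr (Sum.inr c)) :=
      (G.subdivision_adj_inl_iff a _).mpr ⟨c, hca, rfl⟩
    have a₂ : G.subdivision.Adj (Sum.inr (Sum.inr c)) (Sum.inr (Sum.inl e)) :=
      (G.subdivision_adj_branch_iff c _).mpr (Or.inl (by rw [hce]))
    have a₃ : G.subdivision.Adj (Sum.inr (Sum.inl e)) (Sum.inr (Sum.inr d)) :=
      (G.subdivision_adj_edge_iff e _).mpr ⟨d, hde, rfl⟩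
    have a₄ : G.subdivision.Adj (Sum.inr (Sum.inr d)) (Sum.inl b) :=
      (G.subdivision_adj_branch_iff d _).mpr (Or.inr ⟨b, hdb, rfl⟩)
    refine ⟨SimpleGraph.Walk.cons a₁ (SimpleGraph.Walk.cons a₂ (SimpleGraph.Walk.cons a₃
      (SimpleGraph.Walk.cons a₄ SimpleGraph.Walk.nil))), ?_, by simp⟩
    simp [SimpleGraph.Walk.isPath_def, hcd, hab]
  obtain ⟨p, hp, hp2⟩ := mkPath hce hde hca hdb
  obtain ⟨p', hp', hp2'⟩ := mkPath hc'e hd'e hc'a hd'b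
  have h := congrArg (fun q : G.subdivision.Path _ _ => q.1.getVert 2) (hA.path_unique ⟨p, hp⟩ ⟨p', hp'⟩)
  simp only [hp2, hp2'] at h
  simpa using h

end SemiGraph

end Literature.AnabelianGeometry.SemiGraphs
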